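import Literature.MathematicalPhysics.QuantumLattice.DuhamelTwoPointProofs
import Literature.MathematicalPhysics.QuantumLattice.LieTrotter
import Mathlib.Analysis.Normed.Group.InfiniteSum
import Mathlib.Analysis.SpecialFunctions.Integrals.Basic
import Mathlib.Topology.Algebra.Order.Floor
import HarnessLib

/-!
# The Dyson (iterated Duhamel) expansion of `e^{t(A + gB)}` for matrices

The finite-dimensional perturbation series behind every weak-coupling expansion of a Gibbs state
`e^{-β(H₀ + U V)}` (Benfatto–Giuliani–Mastropietro 2006, §2.1, (2.6)–(2.8): "the usual formal power
series in `U` for the partition function and for the Schwinger functions", there rewritten as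
Grassmann integrals; here at the operator level, where it CONVERGES for every `U` in finite
volume). For square complex matrices `A, B` and a complex coupling `g`:

* `Matrix.duhamelOp A B G t = ∫₀ᵗ G(u) B e^{(t-u)A} du` — the variation-of-constants operator;
* `Matrix.dysonTerm A B k t` — the Dyson terms `E₀(t) = e^{tA}`, `E_{k+1} = 𝒦 E_k`, i.e.
  `E_k(t) = ∫_{0<u_1<…<u_k<t} e^{u_1 A} B e^{(u_2-u_1)A} B ⋯ B e^{(t-u_k)A} du` (iterated form);
* `Matrix.exp_smul_add_smul_eq_exp_add_duhamelOp` — Duhamel's formula in variation-of-constants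
  form `e^{t(A+gB)} = e^{tA} + g ∫₀ᵗ e^{u(A+gB)} B e^{(t-u)A} du` (from the tree's
  `Matrix.exp_add_eq_exp_add_integral`, rescaled);
* `Matrix.exp_smul_add_smul_eq_sum_add_remainder` — the expansion to order `N` with remainder
  `e^{t(A+gB)} = Σ_{k<N} g^k E_k(t) + g^N R_N(t)`, `R_0 = e^{t(A+gB)}`, `R_{N+1} = 𝒦 R_N`;
* the factorial bounds `‖E_k(t)‖ ≤ (t‖B‖)^k e^{t‖A‖} / k!` and
  `‖R_N(t)‖ ≤ (t‖B‖)^N e^{t(‖A‖ + |g|‖B‖)} / N!` for `t ≥ 0` (`norm_dysonTerm_le`,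
  `norm_dysonRemainder_le`, operator norm);
* **`Matrix.hasSum_dysonTerm`** — the Dyson series converges to the perturbed exponential:
  `HasSum (k ↦ g^k • E_k(t)) (e^{t(A+gB)})` for every `t ≥ 0` and every `g ∈ ℂ`;
* Gibbs weights: `hasSum_dyson_gibbsWeight` (`e^{-β(H₀+gV)} = Σ_k g^k E_k(1)` with `A = -βH₀`,
  `B = -βV`) and `hasSum_dyson_trace_gibbsWeight_mul` — for every observable `O`,
  `Tr(e^{-β(H₀+gV)} O) = Σ_k g^k Tr(E_k(1) O)`: the un-normalised expectation is an entire power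
  series in the coupling whose coefficients are iterated imaginary-time integrals of free
  (`H₀`-) quantities.

Everything is PROVED; only the three definitions `duhamelOp`, `dysonTerm`, `dysonRemainder` are
introduced.

## References

* O. Bratteli, D. W. Robinson, *Operator Algebras and QSM I*, 2nd ed. (1987), Thm. 3.1.33
  (perturbation expansion of `e^{t(S+P)}` for bounded `P`). [BratteliRobinsonI1987]
* O. Bratteli, D. W. Robinson, *Operator Algebras and QSM II*, 2nd ed. (1997), §5.4.1
  (perturbations of Gibbs/KMS states, Dyson series). [BratteliRobinsonII1997]
* G. Benfatto, A. Giuliani, V. Mastropietro, Ann. Henri Poincaré 7 (2006) 809–898, §2.1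
  (2.6)–(2.8). [BenfattoGiulianiMastropietro2006]
-/

noncomputable section

open scoped Matrix.Norms.L2Operator
open Finset MeasureTheory intervalIntegral Filter Topology NormedSpace

namespace Matrix

variable {m : Type*} [Fintype m] [DecidableEq m]

/-! ### Continuity helpers -/

/-- `u ↦ e^{uX} C e^{(t-u)A}` is continuous. [folklore] -/
theorem continuous_exp_smul_mul_mul_exp_sub (X C A : Matrix m m ℂ) (t : ℝ) :
    Continuous fun u : ℝ => exp (u • X) * C * exp ((t - u) • A) := by
  letI : NormedAlgebra ℚ (Matrix m m ℂ) := .restrictScalars ℚ ℂ _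
  fun_prop

/-- `u ↦ G(u) C e^{s • A}`-type products of a continuous `G` with exponentials are continuous. [folklore] -/
theorem continuous_mul_mul_exp_smul {G : ℝ → Matrix m m ℂ} (hG : Continuous G) (C A : Matrix m m ℂ)
    {φ : ℝ → ℝ} (hφ : Continuous φ) : Continuous fun u : ℝ => G u * C * exp (φ u • A) := by
  letI : NormedAlgebra ℚ (Matrix m m ℂ) := .restrictScalars ℚ ℂ _
  fun_prop

/-- `e^{(t-u)A} = e^{-uA} e^{tA}`. [folklore] -/
theorem exp_sub_smul_eq (A : Matrix m m ℂ) (t u : ℝ) : exp ((t - u) • A) = exp ((-u) • A) * exp (t • A) := by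
  rw [← Matrix.exp_add_of_commute _ _ (((Commute.refl A).smul_left _).smul_right _), ← add_smul]
  congr 1
  rw [neg_add_eq_sub]

/-! ### The variation-of-constants operator and the Dyson terms -/

/-- The **variation-of-constants (Duhamel) operator** of the pair `(A, B)`:
`𝒦 G (t) = ∫₀ᵗ G(u) B e^{(t-u)A} du`. [cite: BratteliRobinsonI1987, Thm. 3.1.33] -/
def duhamelOp (A B : Matrix m m ℂ) (G : ℝ → Matrix m m ℂ) (t : ℝ) : Matrix m m ℂ :=
  ∫ u in (0:ℝ)..t, G u * B * exp ((t - u) • A)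

/-- The **Dyson terms** `E_k(t)`: `E₀(t) = e^{tA}`, `E_{k+1} = 𝒦 E_k`, i.e. the `k`-fold iterated
integral `∫_{0<u₁<⋯<u_k<t} e^{u₁A} B e^{(u₂-u₁)A} B ⋯ B e^{(t-u_k)A} du`.
[cite: BratteliRobinsonI1987, Thm. 3.1.33] -/
def dysonTerm (A B : Matrix m m ℂ) : ℕ → ℝ → Matrix m m ℂ
  | 0 => fun t => exp (t • A)
  | k + 1 => duhamelOp A B (dysonTerm A B k)

/-- The **Dyson remainders** `R_N(t)`: `R₀(t) = e^{t(A+gB)}`, `R_{N+1} = 𝒦 R_N`.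
[cite: BratteliRobinsonI1987, Thm. 3.1.33] -/
def dysonRemainder (A B : Matrix m m ℂ) (g : ℂ) : ℕ → ℝ → Matrix m m ℂ
  | 0 => fun t => exp (t • (A + g • B))
  | N + 1 => duhamelOp A B (dysonRemainder A B g N)

/-- `E₀(t) = e^{tA}`. [folklore] -/
@[simp] theorem dysonTerm_zero (A B : Matrix m m ℂ) (t : ℝ) : dysonTerm A B 0 t = exp (t • A) := rfl

/-- `E_{k+1} = 𝒦 E_k`. [folklore] -/
theorem dysonTerm_succ (A B : Matrix m m ℂ) (k : ℕ) : dysonTerm A B (k + 1) = duhamelOp A B (dysonTerm A B k) := rfl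

/-- `R₀(t) = e^{t(A+gB)}`. [folklore] -/
@[simp] theorem dysonRemainder_zero (A B : Matrix m m ℂ) (g : ℂ) (t : ℝ) :
    dysonRemainder A B g 0 t = exp (t • (A + g • B)) := rfl

/-- `R_{N+1} = 𝒦 R_N`. [folklore] -/
theorem dysonRemainder_succ (A B : Matrix m m ℂ) (g : ℂ) (N : ℕ) :
    dysonRemainder A B g (N + 1) = duhamelOp A B (dysonRemainder A B g N) := rfl

/-- `𝒦 G (t) = (∫₀ᵗ G(u) B e^{-uA} du) e^{tA}`: a primitive times a smooth factor. [folklore] -/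
theorem duhamelOp_eq_integral_mul {A B : Matrix m m ℂ} {G : ℝ → Matrix m m ℂ} (hG : Continuous G) (t : ℝ) :
    duhamelOp A B G t = (∫ u in (0:ℝ)..t, G u * B * exp ((-u) • A)) * exp (t • A) := by
  set L : Matrix m m ℂ →L[ℝ] Matrix m m ℂ :=
    LinearMap.toContinuousLinearMap ((LinearMap.mulRight ℂ (exp (t • A))).restrictScalars ℝ) with hL
  have hLapply : ∀ X : Matrix m m ℂ, L X = X * exp (t • A) := fun X => rfl
  rw [← hLapply, ← L.intervalIntegral_comp_comm ((continuous_mul_mul_exp_smul hG B A continuous_neg).intervalIntegrable 0 t)]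
  refine intervalIntegral.integral_congr fun u _ => ?_
  simp only [hLapply]
  rw [Matrix.mul_assoc (G u * B), ← exp_sub_smul_eq]

/-- `𝒦 G` is continuous for continuous `G`. [folklore] -/
theorem continuous_duhamelOp {A B : Matrix m m ℂ} {G : ℝ → Matrix m m ℂ} (hG : Continuous G) :
    Continuous (duhamelOp A B G) := by
  letI : NormedAlgebra ℚ (Matrix m m ℂ) := .restrictScalars ℚ ℂ _
  have h : duhamelOp A B G = fun t => (∫ u in (0:ℝ)..t, G u * B * exp ((-u) • A)) * exp (t • A) :=
    funext (duhamelOp_eq_integral_mul hG)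
  rw [h]
  refine Continuous.mul ?_ (by fun_prop)
  exact intervalIntegral.continuous_primitive
    (fun a b => (continuous_mul_mul_exp_smul hG B A continuous_neg).intervalIntegrable a b) 0

/-- The Dyson terms are continuous in `t`. [folklore] -/
theorem continuous_dysonTerm (A B : Matrix m m ℂ) : ∀ k, Continuous (dysonTerm A B k)
  | 0 => by
    letI : NormedAlgebra ℚ (Matrix m m ℂ) := .restrictScalars ℚ ℂ _
    show Continuous fun t : ℝ => exp (t • A)
    fun_prop
  | k + 1 => continuous_duhamelOp (continuous_dysonTerm A B k)

/-- The Dyson remainders are continuous in `t`. [folklore] -/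
theorem continuous_dysonRemainder (A B : Matrix m m ℂ) (g : ℂ) : ∀ N, Continuous (dysonRemainder A B g N)
  | 0 => by
    letI : NormedAlgebra ℚ (Matrix m m ℂ) := .restrictScalars ℚ ℂ _
    show Continuous fun t : ℝ => exp (t • (A + g • B))
    fun_prop
  | N + 1 => continuous_duhamelOp (continuous_dysonRemainder A B g N)

/-- `𝒦` is additive on continuous functions. [folklore] -/
theorem duhamelOp_add {A B : Matrix m m ℂ} {G G' : ℝ → Matrix m m ℂ} (hG : Continuous G) (hG' : Continuous G') (t : ℝ) :
    duhamelOp A B (fun u => G u + G' u) t = duhamelOp A B G t + duhamelOp A B G' t := by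
  unfold duhamelOp
  have hφ : Continuous fun u : ℝ => t - u := continuous_const.sub continuous_id
  rw [← intervalIntegral.integral_add ((continuous_mul_mul_exp_smul hG B A hφ).intervalIntegrable 0 t)
    ((continuous_mul_mul_exp_smul hG' B A hφ).intervalIntegrable 0 t)]
  refine intervalIntegral.integral_congr fun u _ => ?_
  simp only [Matrix.add_mul]

/-- `𝒦` commutes with complex scalars. [folklore] -/
theorem duhamelOp_smul (A B : Matrix m m ℂ) (G : ℝ → Matrix m m ℂ) (g : ℂ) (t : ℝ) :
    duhamelOp A B (fun u => g • G u) t = g • duhamelOp A B G t := by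
  unfold duhamelOp
  rw [← intervalIntegral.integral_smul]
  refine intervalIntegral.integral_congr fun u _ => ?_
  simp only [Matrix.smul_mul]

/-! ### Duhamel's formula in variation-of-constants form -/

/-- **Duhamel's formula (variation of constants)**:
`e^{t(A+gB)} = e^{tA} + g ∫₀ᵗ e^{u(A+gB)} B e^{(t-u)A} du`, i.e. `R₀ = E₀ + g 𝒦 R₀`.
[cite: BratteliRobinsonI1987, Thm. 3.1.33] -/
theorem exp_smul_add_smul_eq_exp_add_duhamelOp (A B : Matrix m m ℂ) (g : ℂ) (t : ℝ) :
    exp (t • (A + g • B)) = exp (t • A) + g • duhamelOp A B (fun u => exp (u • (A + g • B))) t := by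
  have h := exp_add_eq_exp_add_integral (t • A) (t • (g • B))
  rw [← smul_add] at h
  rw [h, add_right_inj]
  -- the integrand at `s` is `t • F (t * s)` with `F u = e^{u(A+gB)} (gB) e^{(t-u)A}`
  set F : ℝ → Matrix m m ℂ := fun u => exp (u • (A + g • B)) * (g • B) * exp ((t - u) • A) with hF
  have hint : ∀ s : ℝ, exp (s • (t • (A + g • B))) * (t • (g • B)) * exp ((1 - s) • (t • A)) = t • F (t * s) := by
    intro s
    simp only [hF, smul_smul]
    rw [mul_smul_comm, smul_mul_assoc, mul_comm s t, show (1 - s) * t = t - t * s by ring]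
  simp_rw [hint]
  rw [intervalIntegral.integral_smul, intervalIntegral.smul_integral_comp_mul_left, mul_zero, mul_one,
    duhamelOp, ← intervalIntegral.integral_smul]
  refine intervalIntegral.integral_congr fun u _ => ?_
  simp only [hF, Matrix.mul_smul, Matrix.smul_mul]

/-! ### The expansion to order `N` with remainder -/

/-- The remainder recursion `R_N = E_N + g R_{N+1}`. [cite: BratteliRobinsonI1987, Thm. 3.1.33] -/
theorem dysonRemainder_eq_dysonTerm_add (A B : Matrix m m ℂ) (g : ℂ) :
    ∀ N (t : ℝ), dysonRemainder A B g N t = dysonTerm A B N t + g • dysonRemainder A B g (N + 1) t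
  | 0, t => by
    rw [dysonRemainder_zero, dysonTerm_zero, dysonRemainder_succ]
    exact exp_smul_add_smul_eq_exp_add_duhamelOp A B g t
  | N + 1, t => by
    have ih : dysonRemainder A B g N = fun u => dysonTerm A B N u + g • dysonRemainder A B g (N + 1) u :=
      funext (dysonRemainder_eq_dysonTerm_add A B g N)
    rw [dysonRemainder_succ, ih, duhamelOp_add (G' := fun u => g • dysonRemainder A B g (N + 1) u) (continuous_dysonTerm A B N)
      ((continuous_dysonRemainder A B g (N + 1)).const_smul g), duhamelOp_smul]
    rfl

/-- **The Dyson expansion to order `N` with remainder**: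
`e^{t(A+gB)} = Σ_{k<N} g^k E_k(t) + g^N R_N(t)`. [cite: BratteliRobinsonI1987, Thm. 3.1.33] -/
theorem exp_smul_add_smul_eq_sum_add_remainder (A B : Matrix m m ℂ) (g : ℂ) (t : ℝ) (N : ℕ) :
    exp (t • (A + g • B)) = ∑ k ∈ Finset.range N, g ^ k • dysonTerm A B k t + g ^ N • dysonRemainder A B g N t := by
  induction N with
  | zero => simp
  | succ N ih =>
    rw [ih, Finset.sum_range_succ, dysonRemainder_eq_dysonTerm_add A B g N t, smul_add, smul_smul, ← pow_succ,
      add_assoc]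

/-! ### Factorial bounds -/

/-- `‖e^{uA}‖ ≤ e^{u‖A‖}` for `u ≥ 0` (operator norm). [folklore] -/
theorem norm_exp_smul_le [Nonempty m] (A : Matrix m m ℂ) {u : ℝ} (hu : 0 ≤ u) : ‖exp (u • A)‖ ≤ Real.exp (u * ‖A‖) := by
  refine (Literature.MathematicalPhysics.QuantumLattice.norm_exp_le ℂ (u • A)).trans ?_
  rw [norm_smul, Real.norm_of_nonneg hu]

/-- **The basic estimate for `𝒦`**: if `‖G(u)‖ ≤ M u^k e^{uc} / k!` on `[0, t]` with `‖A‖ ≤ c`,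
then `‖𝒦 G (t)‖ ≤ M ‖B‖ t^{k+1} e^{tc} / (k+1)!`. [cite: BratteliRobinsonI1987, Thm. 3.1.33 (proof)] -/
theorem norm_duhamelOp_le [Nonempty m] {A B : Matrix m m ℂ} {G : ℝ → Matrix m m ℂ} (hG : Continuous G)
    {M c t : ℝ} (hM : 0 ≤ M) (hc : ‖A‖ ≤ c) (ht : 0 ≤ t) {k : ℕ}
    (hb : ∀ u ∈ Set.Icc 0 t, ‖G u‖ ≤ M * u ^ k * Real.exp (u * c) / k.factorial) :
    ‖duhamelOp A B G t‖ ≤ M * ‖B‖ * t ^ (k + 1) * Real.exp (t * c) / (k + 1).factorial := by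
  have hφ : Continuous fun u : ℝ => t - u := continuous_const.sub continuous_id
  have hcont : Continuous fun u : ℝ => G u * B * exp ((t - u) • A) := continuous_mul_mul_exp_smul hG B A hφ
  have h1 : ‖duhamelOp A B G t‖ ≤ ∫ u in (0:ℝ)..t, ‖G u * B * exp ((t - u) • A)‖ :=
    intervalIntegral.norm_integral_le_integral_norm ht
  have h2 : ∫ u in (0:ℝ)..t, ‖G u * B * exp ((t - u) • A)‖ ≤
      ∫ u in (0:ℝ)..t, M * ‖B‖ * Real.exp (t * c) / k.factorial * u ^ k := by
    refine intervalIntegral.integral_mono_on ht (hcont.norm.intervalIntegrable 0 t)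
      ((continuous_const.mul (continuous_pow k)).intervalIntegrable 0 t) fun u hu => ?_
    have hu0 : 0 ≤ u := hu.1
    have hut : u ≤ t := hu.2
    have hexpA : ‖exp ((t - u) • A)‖ ≤ Real.exp ((t - u) * c) :=
      (norm_exp_smul_le A (sub_nonneg.2 hut)).trans (Real.exp_le_exp.2 (mul_le_mul_of_nonneg_left hc (sub_nonneg.2 hut)))
    calc ‖G u * B * exp ((t - u) • A)‖ ≤ ‖G u‖ * ‖B‖ * ‖exp ((t - u) • A)‖ :=
          (l2_opNorm_mul _ _).trans (mul_le_mul_of_nonneg_right (l2_opNorm_mul _ _) (norm_nonneg _))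
      _ ≤ M * u ^ k * Real.exp (u * c) / k.factorial * ‖B‖ * Real.exp ((t - u) * c) := by
          have hnn : 0 ≤ M * u ^ k * Real.exp (u * c) / k.factorial * ‖B‖ := by positivity
          exact mul_le_mul (mul_le_mul_of_nonneg_right (hb u hu) (norm_nonneg _)) hexpA (norm_nonneg _) hnn
      _ = M * ‖B‖ * Real.exp (t * c) / k.factorial * u ^ k := by
          have : Real.exp (u * c) * Real.exp ((t - u) * c) = Real.exp (t * c) := by
            rw [← Real.exp_add]; congr 1; ring
          rw [← this]
          ring
  have h3 : ∫ u in (0:ℝ)..t, M * ‖B‖ * Real.exp (t * c) / k.factorial * u ^ k =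
      M * ‖B‖ * t ^ (k + 1) * Real.exp (t * c) / (k + 1).factorial := by
    rw [intervalIntegral.integral_const_mul, integral_pow, zero_pow (Nat.succ_ne_zero k), sub_zero, Nat.factorial_succ]
    push_cast
    have hk : (k.factorial : ℝ) ≠ 0 := by exact_mod_cast (Nat.factorial_pos k).ne'
    have hk1 : ((k : ℝ) + 1) ≠ 0 := by positivity
    field_simp
  exact h1.trans (h2.trans_eq h3)

/-- **Bound on the Dyson terms**: `‖E_k(t)‖ ≤ ‖B‖^k t^k e^{t‖A‖} / k!` for `t ≥ 0`.
[cite: BratteliRobinsonI1987, Thm. 3.1.33] -/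
theorem norm_dysonTerm_le [Nonempty m] (A B : Matrix m m ℂ) :
    ∀ (k : ℕ) {t : ℝ}, 0 ≤ t → ‖dysonTerm A B k t‖ ≤ ‖B‖ ^ k * t ^ k * Real.exp (t * ‖A‖) / k.factorial
  | 0, t, ht => by
    rw [dysonTerm_zero, pow_zero, pow_zero, one_mul, one_mul, Nat.factorial_zero, Nat.cast_one, div_one]
    exact norm_exp_smul_le A ht
  | k + 1, t, ht => by
    rw [dysonTerm_succ]
    have h := norm_duhamelOp_le (B := B) (continuous_dysonTerm A B k) (M := ‖B‖ ^ k) (c := ‖A‖) (pow_nonneg (norm_nonneg _) k)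
      le_rfl ht (k := k) fun u hu => norm_dysonTerm_le A B k hu.1
    calc ‖duhamelOp A B (dysonTerm A B k) t‖ ≤ ‖B‖ ^ k * ‖B‖ * t ^ (k + 1) * Real.exp (t * ‖A‖) / (k + 1).factorial := h
      _ = ‖B‖ ^ (k + 1) * t ^ (k + 1) * Real.exp (t * ‖A‖) / (k + 1).factorial := by rw [pow_succ ‖B‖]

/-- **Bound on the Dyson remainders**: `‖R_N(t)‖ ≤ ‖B‖^N t^N e^{t(‖A‖ + |g|‖B‖)} / N!` for
`t ≥ 0`. [cite: BratteliRobinsonI1987, Thm. 3.1.33] -/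
theorem norm_dysonRemainder_le [Nonempty m] (A B : Matrix m m ℂ) (g : ℂ) :
    ∀ (N : ℕ) {t : ℝ}, 0 ≤ t →
      ‖dysonRemainder A B g N t‖ ≤ ‖B‖ ^ N * t ^ N * Real.exp (t * (‖A‖ + ‖g‖ * ‖B‖)) / N.factorial
  | 0, t, ht => by
    rw [dysonRemainder_zero, pow_zero, pow_zero, one_mul, one_mul, Nat.factorial_zero, Nat.cast_one, div_one]
    refine (norm_exp_smul_le (A + g • B) ht).trans (Real.exp_le_exp.2 (mul_le_mul_of_nonneg_left ?_ ht))
    calc ‖A + g • B‖ ≤ ‖A‖ + ‖g • B‖ := norm_add_le _ _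
      _ = ‖A‖ + ‖g‖ * ‖B‖ := by rw [norm_smul]
  | N + 1, t, ht => by
    rw [dysonRemainder_succ]
    have hc : ‖A‖ ≤ ‖A‖ + ‖g‖ * ‖B‖ := le_add_of_nonneg_right (mul_nonneg (norm_nonneg _) (norm_nonneg _))
    have h := norm_duhamelOp_le (B := B) (continuous_dysonRemainder A B g N) (M := ‖B‖ ^ N) (c := ‖A‖ + ‖g‖ * ‖B‖)
      (pow_nonneg (norm_nonneg _) N) hc ht (k := N) fun u hu => norm_dysonRemainder_le A B g N hu.1
    calc ‖duhamelOp A B (dysonRemainder A B g N) t‖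
        ≤ ‖B‖ ^ N * ‖B‖ * t ^ (N + 1) * Real.exp (t * (‖A‖ + ‖g‖ * ‖B‖)) / (N + 1).factorial := h
      _ = ‖B‖ ^ (N + 1) * t ^ (N + 1) * Real.exp (t * (‖A‖ + ‖g‖ * ‖B‖)) / (N + 1).factorial := by rw [pow_succ ‖B‖]

/-! ### Convergence of the Dyson series -/

/-- The Dyson series is absolutely convergent: `Σ_k ‖g^k E_k(t)‖ < ∞` for `t ≥ 0`. [cite: BratteliRobinsonI1987, Thm. 3.1.33] -/
theorem summable_norm_dysonTerm (A B : Matrix m m ℂ) (g : ℂ) {t : ℝ} (ht : 0 ≤ t) :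
    Summable fun k => ‖g ^ k • dysonTerm A B k t‖ := by
  cases isEmpty_or_nonempty m with
  | inl h =>
    refine Summable.of_norm_bounded (g := fun _ => (0 : ℝ)) summable_zero fun k => ?_
    rw [Subsingleton.elim (g ^ k • dysonTerm A B k t) 0, norm_norm, norm_zero]
  | inr h =>
    have hs : Summable fun k : ℕ => (‖g‖ * ‖B‖ * t) ^ k / k.factorial * Real.exp (t * ‖A‖) :=
      (Real.summable_pow_div_factorial _).mul_right _
    refine Summable.of_nonneg_of_le (fun k => norm_nonneg _) (fun k => ?_) hs
    rw [norm_smul, norm_pow]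
    calc ‖g‖ ^ k * ‖dysonTerm A B k t‖ ≤ ‖g‖ ^ k * (‖B‖ ^ k * t ^ k * Real.exp (t * ‖A‖) / k.factorial) :=
          mul_le_mul_of_nonneg_left (norm_dysonTerm_le A B k ht) (pow_nonneg (norm_nonneg _) k)
      _ = (‖g‖ * ‖B‖ * t) ^ k / k.factorial * Real.exp (t * ‖A‖) := by rw [mul_pow, mul_pow]; ring

/-- **Convergence of the Dyson series**: `e^{t(A+gB)} = Σ_{k≥0} g^k E_k(t)` for every `t ≥ 0` and
every complex coupling `g` (the remainder `g^N R_N(t)` is `O((|g|‖B‖t)^N/N!)`).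
[cite: BratteliRobinsonI1987, Thm. 3.1.33] -/
theorem hasSum_dysonTerm (A B : Matrix m m ℂ) (g : ℂ) {t : ℝ} (ht : 0 ≤ t) :
    HasSum (fun k => g ^ k • dysonTerm A B k t) (exp (t • (A + g • B))) := by
  rw [hasSum_iff_tendsto_nat_of_summable_norm (summable_norm_dysonTerm A B g ht)]
  cases isEmpty_or_nonempty m with
  | inl h =>
    refine tendsto_const_nhds.congr fun N => ?_
    exact Subsingleton.elim _ _
  | inr h =>
    refine Metric.tendsto_atTop.2 fun ε hε => ?_
    -- the remainder bound `(‖g‖‖B‖t)^N/N! · e^{t(‖A‖+‖g‖‖B‖)} → 0`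
    have hlim : Tendsto (fun N : ℕ => (‖g‖ * ‖B‖ * t) ^ N / N.factorial * Real.exp (t * (‖A‖ + ‖g‖ * ‖B‖))) atTop (𝓝 0) := by
      have h0 := (FloorSemiring.tendsto_pow_div_factorial_atTop (‖g‖ * ‖B‖ * t)).mul_const (Real.exp (t * (‖A‖ + ‖g‖ * ‖B‖)))
      rwa [zero_mul] at h0
    obtain ⟨N₀, hN₀⟩ := Metric.tendsto_atTop.1 hlim ε hε
    refine ⟨N₀, fun N hN => ?_⟩
    have hb := hN₀ N hN
    rw [Real.dist_eq, sub_zero, abs_of_nonneg (by positivity)] at hb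
    rw [dist_eq_norm, exp_smul_add_smul_eq_sum_add_remainder A B g t N, sub_add_cancel_left, norm_neg, norm_smul, norm_pow]
    calc ‖g‖ ^ N * ‖dysonRemainder A B g N t‖
        ≤ ‖g‖ ^ N * (‖B‖ ^ N * t ^ N * Real.exp (t * (‖A‖ + ‖g‖ * ‖B‖)) / N.factorial) :=
          mul_le_mul_of_nonneg_left (norm_dysonRemainder_le A B g N ht) (pow_nonneg (norm_nonneg _) N)
      _ = (‖g‖ * ‖B‖ * t) ^ N / N.factorial * Real.exp (t * (‖A‖ + ‖g‖ * ‖B‖)) := by rw [mul_pow, mul_pow]; ring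
      _ < ε := hb

/-- The Dyson series at `t = 1`: `e^{A+gB} = Σ_{k≥0} g^k E_k(1)`. [cite: BratteliRobinsonI1987, Thm. 3.1.33] -/
theorem hasSum_dysonTerm_one (A B : Matrix m m ℂ) (g : ℂ) :
    HasSum (fun k => g ^ k • dysonTerm A B k 1) (exp (A + g • B)) := by
  have h := hasSum_dysonTerm A B g zero_le_one
  rwa [one_smul] at h

/-- `tsum` form of the Dyson series. [cite: BratteliRobinsonI1987, Thm. 3.1.33] -/
theorem exp_add_smul_eq_tsum_dysonTerm (A B : Matrix m m ℂ) (g : ℂ) :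
    exp (A + g • B) = ∑' k, g ^ k • dysonTerm A B k 1 :=
  (hasSum_dysonTerm_one A B g).tsum_eq.symm

/-! ### Gibbs weights: the perturbation series in the coupling -/

/-- **Dyson expansion of the Gibbs weight**: `e^{-β(H₀+gV)} = Σ_k g^k E_k(1)` with `A = -βH₀`,
`B = -βV` — an entire power series in the coupling `g`, in every finite volume.
[cite: BenfattoGiulianiMastropietro2006, §2.1 (2.6)] -/
theorem hasSum_dyson_gibbsWeight (β : ℝ) (H₀ V : Matrix m m ℂ) (g : ℂ) :
    HasSum (fun k => g ^ k • dysonTerm (-(β : ℂ) • H₀) (-(β : ℂ) • V) k 1) (gibbsWeight β (H₀ + g • V)) := by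
  have h := hasSum_dysonTerm_one (-(β : ℂ) • H₀) (-(β : ℂ) • V) g
  rwa [smul_comm g, ← smul_add] at h

/-- **Dyson expansion of un-normalised expectations**: for every observable `O`,
`Tr(e^{-β(H₀+gV)} O) = Σ_k g^k Tr(E_k(1) O)` — the numerator of the Gibbs expectation is an entire
power series in the coupling whose coefficients are iterated imaginary-time integrals of `H₀`-quantities.
[cite: BenfattoGiulianiMastropietro2006, §2.1 (2.8)] -/
theorem hasSum_dyson_trace_gibbsWeight_mul (β : ℝ) (H₀ V O : Matrix m m ℂ) (g : ℂ) :
    HasSum (fun k => g ^ k * (dysonTerm (-(β : ℂ) • H₀) (-(β : ℂ) • V) k 1 * O).trace)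
      ((gibbsWeight β (H₀ + g • V) * O).trace) := by
  set L : Matrix m m ℂ →L[ℂ] ℂ :=
    LinearMap.toContinuousLinearMap ((Matrix.traceLinearMap m ℂ ℂ) ∘ₗ (LinearMap.mulRight ℂ O)) with hL
  have hLapply : ∀ X : Matrix m m ℂ, L X = (X * O).trace := fun X => rfl
  have h := (hasSum_dyson_gibbsWeight β H₀ V g).mapL L
  simp only [hLapply, Matrix.smul_mul, trace_smul, smul_eq_mul] at h
  exact h

/-- In particular the partition function: `Tr e^{-β(H₀+gV)} = Σ_k g^k Tr E_k(1)`.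
[cite: BenfattoGiulianiMastropietro2006, §2.1 (2.6)] -/
theorem hasSum_dyson_partitionFn (β : ℝ) (H₀ V : Matrix m m ℂ) (g : ℂ) :
    HasSum (fun k => g ^ k * (dysonTerm (-(β : ℂ) • H₀) (-(β : ℂ) • V) k 1).trace) (partitionFn β (H₀ + g • V)) := by
  have h := hasSum_dyson_trace_gibbsWeight_mul β H₀ V 1 g
  simp only [Matrix.mul_one] at h
  exact h

end Matrix

end
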